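import Literature.NumberTheory.ModularForms.QAsymptotics
import Literature.NumberTheory.Automorphic.UnboundedDenominatorsReductions
import HarnessLib

/-!
# Second-order `q`-asymptotics at `i∞`: `E₂ = 1 − 24q + O(q²)`, `E₄ = 1 + 240q + O(q²)`,
# `E₆ = 1 − 504q + O(q²)`, `Δ = q + O(q²)` (CKMRV §2.1.1 (2.1), (2.3))

Cohn–Kumar–Miller–Radchenko–Viazovska, arXiv:1902.05438, §2.1.1: (2.1) `E₄(z) = 1 + 240q + 2160q² + ⋯`,
`E₆(z) = 1 − 504q − 16632q² − ⋯`, `Δ(z) = q − 24q² + 252q³ − ⋯`; (2.3) `E₂(z) = 1 − 24q − 72q² − ⋯`.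

A general tail lemma (`isBigO_hasSum_tail`: a `q`-series with polynomially bounded coefficients
equals its first two terms up to `O(|q|²)` along `atImInfty`) and its application to the
`q`-expansions of `E₂` (Mathlib `hasSum_qExpansion_E2`), `E₄`, `E₆` (Mathlib
`EisensteinSeries.E_qExpansion_coeff` via the tree's `E₄_qExpansion_coeff`, `E₆_qExpansion_coeff`)
and `Δ = (E₄³ − E₆²)/1728`. All proved.

## References

* H. Cohn, A. Kumar, S. D. Miller, D. Radchenko, M. Viazovska, Ann. of Math. 196 (2022),
  arXiv:1902.05438, §2.1.1 (2.1), (2.3). [CohnEtAl2019]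
-/

noncomputable section

open Complex hiding I
open Filter Topology Asymptotics ModularForm SlashInvariantForm EisensteinSeries
open UpperHalfPlane hiding I
open Complex (I)
open scoped Real MatrixGroups ModularForm Manifold ArithmeticFunction.sigma

namespace Literature.NumberTheory.ModularForms

/-! ## A general tail lemma for `q`-series -/

/-- **Tail lemma.** If `f(τ) = Σ aₙ b(τ)ⁿ` with `‖aₙ‖ ≤ C nᵏ`, `‖b‖ < 1` and `‖b(τ)‖ → 0` at `i∞`,
then `f − a₀ − a₁b = O(‖b‖²)` along `atImInfty`. [folklore] -/
theorem isBigO_hasSum_tail {b f : ℍ → ℂ} {a : ℕ → ℂ} {C : ℝ} {k : ℕ} (hC : 0 ≤ C)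
    (ha : ∀ n, 2 ≤ n → ‖a n‖ ≤ C * (n : ℝ) ^ k) (hb0 : Tendsto (fun τ => ‖b τ‖) atImInfty (𝓝 0))
    (hf : ∀ τ, HasSum (fun n => a n * b τ ^ n) (f τ)) :
    (fun τ => f τ - a 0 - a 1 * b τ) =O[atImInfty] fun τ => ‖b τ‖ ^ 2 := by
  -- the majorant series `Σ C (m+2)ᵏ 2⁻ᵐ`
  have hgeom : Summable fun m : ℕ => ((m + 2 : ℕ) : ℝ) ^ k * (1 / 2 : ℝ) ^ (m + 2) := by
    have := summable_pow_mul_geometric_of_norm_lt_one k (r := (1 / 2 : ℝ)) (by norm_num)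
    exact (summable_nat_add_iff 2).mpr this
  set S : ℝ := ∑' m : ℕ, C * (((m + 2 : ℕ) : ℝ) ^ k * (1 / 2 : ℝ) ^ (m + 2) * 4) with hS
  have hSsum : HasSum (fun m : ℕ => C * (((m + 2 : ℕ) : ℝ) ^ k * (1 / 2 : ℝ) ^ (m + 2) * 4)) S :=
    ((hgeom.mul_right 4).mul_left C).hasSum
  refine IsBigO.of_bound S ?_
  have hev : ∀ᶠ τ : ℍ in atImInfty, ‖b τ‖ ≤ 1 / 2 :=
    (hb0.eventually (eventually_le_nhds (by norm_num : (0 : ℝ) < 1 / 2)))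
  filter_upwards [hev] with τ hτ
  have hb1 : ‖b τ‖ < 1 := by linarith
  -- the tail as a series
  have htail : HasSum (fun m : ℕ => a (m + 2) * b τ ^ (m + 2)) (f τ - a 0 - a 1 * b τ) := by
    have := (hasSum_nat_add_iff' 2).mpr (hf τ)
    simpa [Finset.sum_range_succ, sub_sub] using this
  rw [Real.norm_of_nonneg (sq_nonneg _), ← htail.tsum_eq]
  refine tsum_of_norm_bounded (hSsum.mul_right (‖b τ‖ ^ 2)) fun m => ?_
  rw [norm_mul, norm_pow]
  have h1 : ‖a (m + 2)‖ ≤ C * ((m + 2 : ℕ) : ℝ) ^ k := by exact_mod_cast ha (m + 2) (by omega)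
  have h2 : ‖b τ‖ ^ (m + 2) ≤ (1 / 2 : ℝ) ^ m * ‖b τ‖ ^ 2 := by
    rw [pow_add]
    exact mul_le_mul_of_nonneg_right (pow_le_pow_left₀ (norm_nonneg _) hτ m) (sq_nonneg _)
  calc ‖a (m + 2)‖ * ‖b τ‖ ^ (m + 2) ≤ (C * ((m + 2 : ℕ) : ℝ) ^ k) * ((1 / 2 : ℝ) ^ m * ‖b τ‖ ^ 2) :=
        mul_le_mul h1 h2 (pow_nonneg (norm_nonneg _) _) (mul_nonneg hC (pow_nonneg (by positivity) _))
    _ = C * (((m + 2 : ℕ) : ℝ) ^ k * (1 / 2 : ℝ) ^ (m + 2) * 4) * ‖b τ‖ ^ 2 := by ring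

/-! ## The base function `q = e^{2πiτ}` -/

/-- `q(τ) = e^{2πiτ}` on `ℍ`. [folklore] -/
def qfun (τ : ℍ) : ℂ := cexp (2 * π * I * τ)

/-- `‖q‖ = e^{−2πy}`. [folklore] -/
theorem norm_qfun (τ : ℍ) : ‖qfun τ‖ = expDecay τ := by
  rw [qfun, Complex.norm_exp, expDecay]
  congr 1
  simp [Complex.mul_re, UpperHalfPlane.coe_im, UpperHalfPlane.coe_re]

/-- `q = qParam 1`. [folklore] -/
theorem qfun_eq_qParam (τ : ℍ) : qfun τ = Function.Periodic.qParam 1 (τ : ℂ) := by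
  simp [qfun, Function.Periodic.qParam]

/-- `‖q(τ)‖ → 0` at `i∞`. [folklore] -/
theorem tendsto_norm_qfun : Tendsto (fun τ => ‖qfun τ‖) atImInfty (𝓝 0) := by
  simp only [norm_qfun]; exact tendsto_expDecay

/-- `σₖ(n) ≤ n^{k+1}` as a real-norm bound on the complex coefficient. [folklore] -/
theorem norm_sigma_le (k n : ℕ) : ‖((σ k n : ℕ) : ℂ)‖ ≤ (n : ℝ) ^ (k + 1) := by
  rw [Complex.norm_natCast]
  exact_mod_cast ArithmeticFunction.sigma_le_pow_succ k n

/-! ## `E₂ = 1 − 24q + O(q²)` -/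

/-- **`E₂ − 1 + 24q = O(q²)`** (CKMRV (2.3)). [cite: CohnEtAl2019, §2.1.1 (2.3)] -/
theorem E2_second_order : (fun τ : ℍ => E2 τ - 1 + 24 * qfun τ) =O[atImInfty] fun τ => expDecay τ ^ 2 := by
  set a : ℕ → ℂ := fun m => if m = 0 then 1 else -24 * (σ 1 m : ℂ) with ha
  have hbound : ∀ n, 2 ≤ n → ‖a n‖ ≤ 24 * (n : ℝ) ^ 2 := by
    intro n hn
    simp only [ha, if_neg (show n ≠ 0 by omega)]
    rw [norm_mul, norm_neg, show ‖(24 : ℂ)‖ = 24 by norm_num]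
    exact mul_le_mul_of_nonneg_left (norm_sigma_le 1 n) (by norm_num)
  have hsum : ∀ τ : ℍ, HasSum (fun n => a n * qfun τ ^ n) (E2 τ) := fun τ => by
    have := EisensteinSeries.hasSum_qExpansion_E2 (z := τ)
    simpa [ha, qfun, smul_eq_mul] using this
  have h := isBigO_hasSum_tail (by norm_num) hbound tendsto_norm_qfun hsum
  refine (h.congr_left fun τ => ?_).congr_right fun τ => by rw [norm_qfun]
  simp [ha]

/-! ## `E₄ = 1 + 240q + O(q²)`, `E₆ = 1 − 504q + O(q²)`, `Δ = q + O(q²)` -/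

open Literature.NumberTheory.Automorphic (E₄_qExpansion_coeff E₆_qExpansion_coeff) in
/-- The `q`-series of a level-one modular form with the coefficients of its `q`-expansion, in the
variable `qfun`. [folklore] -/
theorem hasSum_levelOne_qfun {k : ℤ} (f : ModularForm 𝒮ℒ k) (τ : ℍ) :
    HasSum (fun m : ℕ => (qExpansion 1 f).coeff m * qfun τ ^ m) (f τ) := by
  have hper : Function.Periodic (⇑f ∘ ofComplex) (1 : ℝ) :=
    SlashInvariantFormClass.periodic_comp_ofComplex f one_mem_strictPeriods_SL
  have := hasSum_qExpansion one_pos hper f.holo' (ModularFormClass.bdd_at_infty f) τ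
  simpa [qfun_eq_qParam, smul_eq_mul] using this

open Literature.NumberTheory.Automorphic (E₄_qExpansion_coeff) in
/-- **`E₄ − 1 − 240q = O(q²)`** (CKMRV (2.1)). [cite: CohnEtAl2019, §2.1.1 (2.1)] -/
theorem E₄_second_order : (fun τ : ℍ => E₄ τ - 1 - 240 * qfun τ) =O[atImInfty] fun τ => expDecay τ ^ 2 := by
  set a : ℕ → ℂ := fun m => (qExpansion 1 E₄).coeff m with ha
  have hcoeff : ∀ m, a m = if m = 0 then 1 else 240 * (σ 3 m : ℂ) := fun m => E₄_qExpansion_coeff m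
  have hbound : ∀ n, 2 ≤ n → ‖a n‖ ≤ 240 * (n : ℝ) ^ 4 := by
    intro n hn
    rw [hcoeff, if_neg (show n ≠ 0 by omega), norm_mul, show ‖(240 : ℂ)‖ = 240 by norm_num]
    exact mul_le_mul_of_nonneg_left (norm_sigma_le 3 n) (by norm_num)
  have h := isBigO_hasSum_tail (by norm_num) hbound tendsto_norm_qfun (hasSum_levelOne_qfun E₄)
  refine (h.congr_left fun τ => ?_).congr_right fun τ => by rw [norm_qfun]
  rw [hcoeff, hcoeff]
  simp

open Literature.NumberTheory.Automorphic (E₆_qExpansion_coeff) in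
/-- **`E₆ − 1 + 504q = O(q²)`** (CKMRV (2.1)). [cite: CohnEtAl2019, §2.1.1 (2.1)] -/
theorem E₆_second_order : (fun τ : ℍ => E₆ τ - 1 + 504 * qfun τ) =O[atImInfty] fun τ => expDecay τ ^ 2 := by
  set a : ℕ → ℂ := fun m => (qExpansion 1 E₆).coeff m with ha
  have hcoeff : ∀ m, a m = if m = 0 then 1 else -504 * (σ 5 m : ℂ) := fun m => E₆_qExpansion_coeff m
  have hbound : ∀ n, 2 ≤ n → ‖a n‖ ≤ 504 * (n : ℝ) ^ 6 := by
    intro n hn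
    rw [hcoeff, if_neg (show n ≠ 0 by omega), norm_mul, norm_neg, show ‖(504 : ℂ)‖ = 504 by norm_num]
    exact mul_le_mul_of_nonneg_left (norm_sigma_le 5 n) (by norm_num)
  have h := isBigO_hasSum_tail (by norm_num) hbound tendsto_norm_qfun (hasSum_levelOne_qfun E₆)
  refine (h.congr_left fun τ => ?_).congr_right fun τ => by rw [norm_qfun]
  rw [hcoeff, hcoeff]
  simp

/-- `q² = O(q)` trivially refined: `expDecay² ≤ expDecay`. [folklore] -/
theorem expDecay_sq_le (τ : ℍ) : expDecay τ ^ 2 ≤ expDecay τ := by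
  have := expDecay_le_one τ
  have h0 := expDecay_pos τ
  nlinarith

/-- Products with a bounded factor: `u = O(1)`, `v = O(g)` ⟹ `uv = O(g)`. [folklore] -/
theorem isBigO_mul_of_isBigO_one {u v : ℍ → ℂ} {g : ℍ → ℝ} (hu : u =O[atImInfty] fun _ : ℍ => (1 : ℝ))
    (hv : v =O[atImInfty] g) : (fun τ => u τ * v τ) =O[atImInfty] g := by
  simpa using hu.mul hv

/-- **`Δ − q = O(q²)`** (CKMRV (2.1): `Δ = q − 24q² + ⋯`), from `1728Δ = E₄³ − E₆²`:
with `X = E₄ − 1`, `Y = E₆ − 1` (both `O(q)`), `A = X − 240q`, `B = Y + 504q` (both `O(q²)`),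
`1728(Δ − q) = 3A − 2B + 3X² + X³ − Y²`. [cite: CohnEtAl2019, §2.1.1 (2.1)] -/
theorem discriminant_second_order :
    (fun τ : ℍ => ModularForm.discriminant τ - qfun τ) =O[atImInfty] fun τ => expDecay τ ^ 2 := by
  have h4 := E₄_second_order
  have h6 := E₆_second_order
  have hX := E₄_sub_one_isBigO
  have hY := E₆_sub_one_isBigO
  have hq1 : (fun τ => expDecay τ) =O[atImInfty] fun _ : ℍ => (1 : ℝ) :=
    IsBigO.of_bound 1 (Eventually.of_forall fun τ => by
      simp [Real.norm_of_nonneg (expDecay_pos τ).le, expDecay_le_one τ])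
  have hX1 : (fun τ : ℍ => E₄ τ - 1) =O[atImInfty] fun _ : ℍ => (1 : ℝ) := hX.trans hq1
  have hXX : (fun τ : ℍ => (E₄ τ - 1) * (E₄ τ - 1)) =O[atImInfty] fun τ => expDecay τ ^ 2 := by
    simpa [sq] using hX.mul hX
  have hYY : (fun τ : ℍ => (E₆ τ - 1) * (E₆ τ - 1)) =O[atImInfty] fun τ => expDecay τ ^ 2 := by
    simpa [sq] using hY.mul hY
  have hXXX : (fun τ : ℍ => (E₄ τ - 1) * ((E₄ τ - 1) * (E₄ τ - 1))) =O[atImInfty] fun τ => expDecay τ ^ 2 :=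
    isBigO_mul_of_isBigO_one hX1 hXX
  have total := ((((h4.const_mul_left 3).sub (h6.const_mul_left 2)).add (hXX.const_mul_left 3)).add hXXX).sub hYY
  refine (total.const_mul_left ((1728 : ℂ)⁻¹)).congr' (Eventually.of_forall fun τ => ?_) EventuallyEq.rfl
  have hΔ := ModularForm.discriminant_eq_E₄_cube_sub_E₆_sq τ
  beta_reduce
  rw [hΔ]
  ring

end Literature.NumberTheory.ModularForms
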